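import Mathlib.MeasureTheory.Integral.IntervalIntegral.FundThmCalculus
import Mathlib.Analysis.SpecialFunctions.ExpDeriv
import Mathlib.Analysis.Calculus.Deriv.MeanValue
import HarnessLib

/-!
# Grönwall's inequality in integral form with a variable (continuous, nonnegative) coefficient

Topic `Literature/Analysis/ODE` (namespace `Literature.Analysis.ODE`). The classical linear integral
inequality (Grönwall 1919; Bellman 1943): if `g, a` are continuous, `a ≥ 0`, `h` is non-decreasing on
`[0, T]` and `g(t) ≤ h(t) + ∫₀ᵗ a(s) g(s) ds` on `[0, T]`, then `g(T) ≤ h(T) exp(∫₀ᵀ a)`.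
Mathlib's `gronwallBound` family (`Mathlib.Analysis.ODE.Gronwall`) covers the differential form with a
CONSTANT coefficient; the variable-coefficient integral form is what pathwise perturbation estimates with
a state-dependent local Lipschitz constant consume (the coefficient enters only through its time
integral `∫₀ᵀ a`, not through its supremum).

* `Literature.Analysis.ODE.gronwall_integral_le` — the statement above (Bellman's form).

Proof: with `A(t) = ∫₀ᵗ a`, `ψ(t) = ∫₀ᵗ a g`, the function `h(T)(1 - e^{-A}) - ψ e^{-A}` has derivative
`a e^{-A} (h(T) - g + ψ) ≥ a e^{-A}(h(T) - h) ≥ 0` on `[0, T]` and vanishes at `0`.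

## References
* T. H. Grönwall, Ann. of Math. 20 (1919) 292–296; R. Bellman, Duke Math. J. 10 (1943) 643–647.
* P. Hartman, *Ordinary Differential Equations* (SIAM 2002), Ch. III Thm 1.1. [folklore]
-/

noncomputable section

open MeasureTheory Set intervalIntegral

namespace Literature.Analysis.ODE

/-- **Grönwall–Bellman inequality (integral form, variable coefficient).** Let `a, g : ℝ → ℝ` be
continuous with `a ≥ 0`, let `h` be non-decreasing on `[0, T]` (`T ≥ 0`), and suppose
`g t ≤ h t + ∫₀ᵗ a s * g s ds` for all `t ∈ [0, T]`. Then `g T ≤ h T * exp (∫₀ᵀ a)`.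
No sign condition on `g` or `h` is needed. [folklore] -/
theorem gronwall_integral_le {a g h : ℝ → ℝ} {T : ℝ} (hT : 0 ≤ T)
    (ha : Continuous a) (hg : Continuous g) (ha0 : ∀ t, 0 ≤ a t)
    (hmono : MonotoneOn h (Icc 0 T))
    (hle : ∀ t ∈ Icc 0 T, g t ≤ h t + ∫ s in (0:ℝ)..t, a s * g s) :
    g T ≤ h T * Real.exp (∫ s in (0:ℝ)..T, a s) := by
  set A : ℝ → ℝ := fun t => ∫ s in (0:ℝ)..t, a s with hAdef
  set ψ : ℝ → ℝ := fun t => ∫ s in (0:ℝ)..t, a s * g s with hψdef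
  have hA : ∀ t, HasDerivAt A (a t) t := fun t =>
    (ha.integral_hasStrictDerivAt 0 t).hasDerivAt
  have hψ : ∀ t, HasDerivAt ψ (a t * g t) t := fun t =>
    ((ha.mul hg).integral_hasStrictDerivAt 0 t).hasDerivAt
  -- the comparison function
  set Φ : ℝ → ℝ := fun t => h T * (1 - Real.exp (-A t)) - ψ t * Real.exp (-A t) with hΦdef
  have hE : ∀ t, HasDerivAt (fun t => Real.exp (-A t)) (-(a t) * Real.exp (-A t)) t := fun t => by
    have := ((hA t).neg).exp
    simpa [mul_comm] using this
  have hΦd : ∀ t, HasDerivAt Φ (a t * Real.exp (-A t) * (h T - g t + ψ t)) t := by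
    intro t
    have h1 : HasDerivAt (fun t => h T * (1 - Real.exp (-A t))) (h T * (0 - (-(a t) * Real.exp (-A t)))) t :=
      ((hasDerivAt_const t (1:ℝ)).sub (hE t)).const_mul (h T)
    have h2 : HasDerivAt (fun t => ψ t * Real.exp (-A t))
        ((a t * g t) * Real.exp (-A t) + ψ t * (-(a t) * Real.exp (-A t))) t := (hψ t).mul (hE t)
    show HasDerivAt (fun t => h T * (1 - Real.exp (-A t)) - ψ t * Real.exp (-A t)) _ t
    refine (h1.sub h2).congr_deriv ?_
    ring
  have hΦc : Continuous Φ := by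
    have hAc : Continuous A := continuous_iff_continuousAt.2 fun t => (hA t).continuousAt
    have hψc : Continuous ψ := continuous_iff_continuousAt.2 fun t => (hψ t).continuousAt
    simp only [hΦdef]
    fun_prop
  -- `Φ` is non-decreasing on `[0, T]`
  have hΦmono : MonotoneOn Φ (Icc 0 T) := by
    refine monotoneOn_of_deriv_nonneg (convex_Icc 0 T) hΦc.continuousOn
      (fun t _ => (hΦd t).differentiableAt.differentiableWithinAt) fun t ht => ?_
    rw [interior_Icc] at ht
    rw [(hΦd t).deriv]
    have hgt := hle t (Ioo_subset_Icc_self ht)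
    have hht : h t ≤ h T := hmono (Ioo_subset_Icc_self ht) (right_mem_Icc.2 hT) ht.2.le
    have h3 : 0 ≤ h T - g t + ψ t := by simp only [hψdef]; linarith
    exact mul_nonneg (mul_nonneg (ha0 t) (Real.exp_pos _).le) h3
  have hΦ0 : Φ 0 = 0 := by simp [hΦdef, hAdef, hψdef]
  have hΦT : 0 ≤ Φ T := by
    rw [← hΦ0]
    exact hΦmono (left_mem_Icc.2 hT) (right_mem_Icc.2 hT) hT
  -- unwind
  have hexp : 0 < Real.exp (-A T) := Real.exp_pos _
  have hprod : Real.exp (-A T) * Real.exp (A T) = 1 := by rw [← Real.exp_add]; simp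
  have hψT : ψ T ≤ h T * (Real.exp (A T) - 1) := by
    have h1 : ψ T * Real.exp (-A T) ≤ h T * (1 - Real.exp (-A T)) := by
      simp only [hΦdef] at hΦT; linarith
    have h2 := mul_le_mul_of_nonneg_right h1 (Real.exp_pos (A T)).le
    calc ψ T = ψ T * Real.exp (-A T) * Real.exp (A T) := by rw [mul_assoc, hprod, mul_one]
      _ ≤ h T * (1 - Real.exp (-A T)) * Real.exp (A T) := h2
      _ = h T * (Real.exp (A T) - 1) := by
          have : (1 - Real.exp (-A T)) * Real.exp (A T) = Real.exp (A T) - 1 := by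
            rw [sub_mul, one_mul, hprod]
          rw [mul_assoc, this]
  have hgT := hle T (right_mem_Icc.2 hT)
  calc g T ≤ h T + ψ T := hgT
    _ ≤ h T + h T * (Real.exp (A T) - 1) := by linarith
    _ = h T * Real.exp (∫ s in (0:ℝ)..T, a s) := by simp only [hAdef]; ring

/-- **Grönwall–Bellman, homogeneous-plus-monotone form on every initial segment**: under the hypotheses
of `gronwall_integral_le`, `g t ≤ h t * exp (∫₀ᵗ a)` for EVERY `t ∈ [0, T]`. [folklore] -/
theorem gronwall_integral_le_on {a g h : ℝ → ℝ} {T : ℝ}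
    (ha : Continuous a) (hg : Continuous g) (ha0 : ∀ t, 0 ≤ a t)
    (hmono : MonotoneOn h (Icc 0 T))
    (hle : ∀ t ∈ Icc 0 T, g t ≤ h t + ∫ s in (0:ℝ)..t, a s * g s) :
    ∀ t ∈ Icc 0 T, g t ≤ h t * Real.exp (∫ s in (0:ℝ)..t, a s) := fun _ ht =>
  gronwall_integral_le ht.1 ha hg ha0 (hmono.mono (Icc_subset_Icc le_rfl ht.2))
    fun s hs => hle s ⟨hs.1, hs.2.trans ht.2⟩

end Literature.Analysis.ODE

end
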